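import Summits.Ventures.Crystal3D.Theorems.StickyWulffConstantCoaxialWallLawVicinalReachCore
import Summits.Ventures.Crystal3D.Theorems.StickyWulffConstantCoaxialWallLawVicinalCoreCapstone
import HarnessLib

/-!
# Capstone: `CoaxialWallLaw` BY NAME ⇐ {E1, `StarPairFar`, the three REACH debts} (crux `CoaxialWallLaw`, stmt-Ventures-19481,
# line `WallLedgerF`)

HONEST FRAMING. Venture `Summits/Ventures/Crystal3D` (cell `crystal3d-full`), helper `--supports` the crux
`CoaxialWallLaw` of `route-Ventures-StickyWulffConstant` (REGISTERED line `WallLedgerF`).  LEAF capstone (nothing should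
import this file).  Book-keeping only; F-C1 not moved; NOT the crux: the reach debts (`…VicinalReachCore`) are OPEN —
`CoaxialTwoSlabAdhesionReachCoherentTwin` (vicinal coherent Σ3 twins; census twin rows, 19481-p2 `…DebtTwinRow` /
`…CensusPlugTwin`), `CoaxialTwoSlabAdhesionReachCoherentFault` (vicinal basal stacking faults; census translation rows),
`CoaxialTwoSlabAdhesionReachIncoherentDeep` (deep offsets registered for every admissible walker vertical: numerically 2.8 % of
wall normals × six level-1/9 classes, kit j313441); `ExactOnly`(C12-55) / `P5Exhaustion` [E1, certified] and `StarPairFar`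
[certified; kernel at computational grade] are inputs BY NAME.

* **`coaxialWallLaw_of_reachSplit`**, **`coaxialWallLaw_of_p5_reachSplit`**; `coaxialWallLaw_of_reach`.
WHAT THIS IS NOT: a proof of any debt; F-C1 not moved.
-/

noncomputable section

namespace Summit.Ventures.Crystal3D.Theorems

open Summit.Ventures.Crystal3D Finset
open Literature.MathematicalPhysics.StatisticalMechanics (fccStacking barlowStacking IsHaggSeq contactDeficiency)
open scoped InnerProductSpace

open scoped Classical in
/-- **The crux `CoaxialWallLaw` BY NAME from `ExactOnly`(C12-55), `StarPairFar` and the reach core.** -/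
theorem coaxialWallLaw_of_reach
    {s₀ : EuclideanSpace ℝ (Fin 3)} (hs₀ : s₀ ∈ fccSlots)
    (hcert : ExactOnly 0 (fccSlots.filter fun w => 0 < ⟪w, s₀⟫_ℝ)) (hSP : StarPairFar)
    (hcore : CoaxialTwoSlabAdhesionReach) :
    Summit.Ventures.Crystal3D.Theses.StickyWulffConstant.CoaxialWallLaw :=
  coaxialWallLaw_of_stubProps Summit.Ventures.Crystal3D.Theorems.stub_affineSampleDeficit
    (coaxialTwoSlabAdhesion_of_reach hs₀ hcert hSP hcore)

open scoped Classical in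
/-- **The crux `CoaxialWallLaw` BY NAME from `ExactOnly`(C12-55), `StarPairFar` and the three reach debts.** -/
theorem coaxialWallLaw_of_reachSplit
    {s₀ : EuclideanSpace ℝ (Fin 3)} (hs₀ : s₀ ∈ fccSlots)
    (hcert : ExactOnly 0 (fccSlots.filter fun w => 0 < ⟪w, s₀⟫_ℝ)) (hSP : StarPairFar)
    (h₁ : CoaxialTwoSlabAdhesionReachCoherentTwin) (h₂ : CoaxialTwoSlabAdhesionReachCoherentFault)
    (h₃ : CoaxialTwoSlabAdhesionReachIncoherentDeep) :
    Summit.Ventures.Crystal3D.Theses.StickyWulffConstant.CoaxialWallLaw :=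
  coaxialWallLaw_of_reach hs₀ hcert hSP (coaxialTwoSlabAdhesionReach_of_split h₁ h₂ h₃)

/-- **The crux `CoaxialWallLaw` BY NAME from `P5Exhaustion` (E1), `StarPairFar` and the three reach debts.** -/
theorem coaxialWallLaw_of_p5_reachSplit (hE1 : P5Exhaustion) (hSP : StarPairFar)
    (h₁ : CoaxialTwoSlabAdhesionReachCoherentTwin) (h₂ : CoaxialTwoSlabAdhesionReachCoherentFault)
    (h₃ : CoaxialTwoSlabAdhesionReachIncoherentDeep) :
    Summit.Ventures.Crystal3D.Theses.StickyWulffConstant.CoaxialWallLaw := by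
  obtain ⟨s₀, hs₀, hcert⟩ := exactOnly_star_of_p5Exhaustion hE1
  exact coaxialWallLaw_of_reachSplit hs₀ hcert hSP h₁ h₂ h₃

end Summit.Ventures.Crystal3D.Theorems

end
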